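import Literature.AlgebraicGeometry.HilbertScheme.HeisenbergMonomialDegrees
import HarnessLib

/-!
# Lane (V), line v2p5 — stub S-F (`stub_span`), JOIN half, part 1: length-graded admissible spans and unit letters

Cell `hodge-kum4`, crux stmt-Ventures-20306 (`LefschetzGenerationHilb5`, W-form), seam `SF.JoinHalf` (plan g19
`SeamSF.v2.lean` d82d0eae62b73f6f; director-hodge g8 12:28:47Z / 12:35:06Z).  Pure algebra over the axioms
`IsHeisenbergRepresentation` (any field `K` with `2 ≠ 0`), in the letter calculus of
`HilbertScheme/HeisenbergMonomialSpanning` (`letterWord`, `IsAdmissibleWord`, `monomialOp`):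

* `admSpanGe q x vac deg r` — the span of the sorted admissible monomials `𝔮_{r₁}(x_{c₁})⋯𝔮_{r_k}(x_{c_k})|0⟩` with AT LEAST
  `r` letters; a creation operator `𝔮ₘ(v)`, `m > 0`, maps `admSpanGe r` into `admSpanGe (r + 1)` (sorted insertion never
  loses a letter), a creation word of length `ℓ` maps it into `admSpanGe (r + ℓ)`, and `ℍₘ ⊆ admSpanGe 1` for `m ≥ 1`
  (the "junk has at least as many parts" bookkeeping of V2-MECHANISM §6);
* unit letters `𝔮ₐ(u)`, `u ∈ A 0` (intended `u = 1_S`), commute with every `𝔮_b(v)` when `a + b ≠ 0`, so the unit monomial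
  `𝔮_{a₁}(u)⋯𝔮_{a_r}(u)` depends only on the multiset of parts (`monomialOp_unitWord_perm`).

HONEST FRAMING: helper lemmas; nothing here asserts S-F ∕ L1-Hilb(n) ∕ L1 ∕ HC_Kum4Type ∕ HC.
-/

noncomputable section

open DirectSum

universe u v w

namespace Summit.Ventures.HodgeKum4.L1Hilb.Join

open Literature.AlgebraicGeometry.HilbertScheme

variable {K : Type u} [Field K]
variable {A : ℕ → Type v} [∀ i, AddCommGroup (A i)] [∀ i, Module K (A i)]
variable {Φ : ℕ → ℕ → Type w} [∀ n i, AddCommGroup (Φ n i)] [∀ n i, Module K (Φ n i)]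
variable {B : (⨁ i, A i) →ₗ[K] (⨁ i, A i) →ₗ[K] K} {q : ℤ → (⨁ i, A i) →ₗ[K] Module.End K (Fock Φ)} {vac : Fock Φ}
variable {N : ℕ} {x : Fin N → ⨁ i, A i} {deg : Fin N → ℕ}

/-! ### 1. Admissible monomials with at least `r` letters -/

/-- The span of the sorted admissible monomials `𝔮_{r₁}(x_{c₁})⋯𝔮_{r_k}(x_{c_k})|0⟩` with at least `r` letters (`k ≥ r`). -/
def admSpanGe (q : ℤ → (⨁ i, A i) →ₗ[K] Module.End K (Fock Φ)) (x : Fin N → ⨁ i, A i) (vac : Fock Φ)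
    (deg : Fin N → ℕ) (r : ℕ) : Submodule K (Fock Φ) :=
  Submodule.span K {w | ∃ L, IsAdmissibleWord deg L ∧ r ≤ L.length ∧ w = monomialOp q (letterWord x L) vac}

/-- `admSpanGe` decreases in `r`. -/
theorem admSpanGe_anti {r r' : ℕ} (h : r ≤ r') : admSpanGe q x vac deg r' ≤ admSpanGe q x vac deg r :=
  Submodule.span_mono fun _ ⟨L, hL, hr, hw⟩ ↦ ⟨L, hL, h.trans hr, hw⟩

/-- A sorted admissible monomial with at least `r` letters lies in `admSpanGe r`. -/
theorem monomialOp_vac_mem_admSpanGe {L : List (Lex (Fin N × ℕ))} (hL : IsAdmissibleWord deg L) {r : ℕ}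
    (hr : r ≤ L.length) : monomialOp q (letterWord x L) vac ∈ admSpanGe q x vac deg r :=
  Submodule.subset_span ⟨L, hL, hr, rfl⟩

/-- In a sorted list, every element from the first one `≥ σ` on is `≥ σ` (list plumbing). -/
theorem le_of_mem_dropWhile {α : Type*} [LinearOrder α] {σ : α} {L : List α}
    (hL : L.Pairwise (· ≤ ·)) : ∀ τ ∈ L.dropWhile (fun τ ↦ decide (τ < σ)), σ ≤ τ := by
  induction L with
  | nil => simp
  | cons a L ih =>
    intro τ hτ
    rw [List.dropWhile_cons] at hτ
    split_ifs at hτ with ha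
    · exact ih (List.pairwise_cons.1 hL).2 τ hτ
    · simp only [decide_eq_true_eq, not_lt] at ha
      rcases List.mem_cons.1 hτ with rfl | hτ'
      · exact ha
      · exact ha.trans ((List.pairwise_cons.1 hL).1 τ hτ')

/-- **Sorted insertion, with the letter count**: for a sorted admissible word `L` and a creation letter `𝔮ₘ(x_c)`, `m ≥ 1`,
either the inserted word `P ++ (c,m) :: S` (`P` = the letters `< (c,m)`, `S` = the rest) is again sorted admissible and
`𝔮ₘ(x_c) · M_L|0⟩ = ± M_{P ++ (c,m) :: S}|0⟩`, or `x_c` is odd and `(c, m)` is already present, and the product vanishes.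
(The computation of `HeisenbergMonomialSpanning.mul_letterMonomial_vac_mem_sortedSpan`, with the result made explicit.) -/
theorem q_letter_apply_eq (h : IsHeisenbergRepresentation B q vac) (h2 : (2 : K) ≠ 0)
    (hx : ∀ c, x c ∈ LinearMap.range (lof K ℕ A (deg c))) {m : ℕ} (hm : 1 ≤ m) (c : Fin N)
    {L : List (Lex (Fin N × ℕ))} (hL : IsAdmissibleWord deg L) :
    let σ : Lex (Fin N × ℕ) := toLex (c, m)
    let P := L.takeWhile (fun τ ↦ decide (τ < σ))
    let S := L.dropWhile (fun τ ↦ decide (τ < σ))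
    (Odd (deg c) ∧ σ ∈ L ∧ q (m : ℤ) (x c) (monomialOp q (letterWord x L) vac) = 0) ∨
      (IsAdmissibleWord deg (P ++ σ :: S) ∧
        q (m : ℤ) (x c) (monomialOp q (letterWord x L) vac) =
          ((-1 : K) ^ (deg c * letterDegSum deg P)) • monomialOp q (letterWord x (P ++ σ :: S)) vac) := by
  intro σ P S
  have hPS : P ++ S = L := List.takeWhile_append_dropWhile
  have hPlt : ∀ τ ∈ P, τ < σ := fun τ hτ ↦ by simpa using List.mem_takeWhile_imp hτ
  have hSge : ∀ τ ∈ S, σ ≤ τ := le_of_mem_dropWhile hL.pairwise_le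
  have hPadm : IsAdmissibleWord deg P := hL.sublist (List.takeWhile_sublist _)
  have hSadm : IsAdmissibleWord deg S := hL.sublist (List.dropWhile_sublist _)
  -- the product `𝔮ₘ(x_c) · M_L = ± M_{P ++ σ :: S}`
  have hprod : q (m : ℤ) (x c) * monomialOp q (letterWord x L) =
      ((-1 : K) ^ (deg c * letterDegSum deg P)) • monomialOp q (letterWord x (P ++ σ :: S)) := by
    rw [← hPS, letterWord_append, monomialOp_append, ← mul_assoc,
      h.mul_letterMonomial_eq_sign_smul hx (by exact_mod_cast hm) c P, smul_mul_assoc, mul_assoc,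
      letterWord_append, letterWord_cons, monomialOp_append, monomialOp_cons]
    rfl
  by_cases hbad : Odd (deg c) ∧ ∃ S', S = σ :: S'
  · -- the new word contains `𝔮ₘ(x_c)𝔮ₘ(x_c) = 0`
    obtain ⟨hodd, S', hS'⟩ := hbad
    obtain ⟨a, ha⟩ := hx c
    have hzero : monomialOp q (letterWord x (P ++ σ :: S)) = 0 := by
      rw [hS', letterWord_append, letterWord_cons, letterWord_cons, monomialOp_append, monomialOp_cons,
        monomialOp_cons, ← mul_assoc (q _ _), show letterColour σ = c from rfl, show (letterPart σ : ℤ) = m from rfl,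
        ← ha, h.mul_self_eq_zero_of_odd h2 (by exact_mod_cast (show m ≠ 0 by omega)) hodd a, zero_mul, mul_zero]
    refine Or.inl ⟨hodd, ?_, ?_⟩
    · rw [← hPS, hS']
      exact List.mem_append_right P List.mem_cons_self
    · rw [← Module.End.mul_apply, hprod, hzero, smul_zero, LinearMap.zero_apply]
  · refine Or.inr ⟨⟨?_, ?_⟩, ?_⟩
    · -- parts `≥ 1`
      intro τ hτ
      rcases List.mem_append.1 hτ with hτ | hτ
      · exact hPadm.1 τ hτ
      · rcases List.mem_cons.1 hτ with rfl | hτ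
        · exact hm
        · exact hSadm.1 τ hτ
    · -- sorted, odd letters not repeated
      have hσS : ∀ τ ∈ S, σ ≤ τ ∧ (Odd (deg (letterColour σ)) → σ ≠ τ) := by
        intro τ hτ
        refine ⟨hSge τ hτ, fun hodd hστ ↦ hbad ⟨hodd, ?_⟩⟩
        cases hS0 : S with
        | nil => rw [hS0] at hτ; exact (List.not_mem_nil hτ).elim
        | cons s₀ S' =>
          refine ⟨S', ?_⟩
          rw [hS0] at hτ hSge hSadm
          have hs₀ : σ ≤ s₀ := hSge s₀ List.mem_cons_self
          rcases List.mem_cons.1 hτ with rfl | hτ'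
          · rw [hστ]
          · have := (List.pairwise_cons.1 hSadm.2).1 τ hτ'
            rw [← hστ] at this
            rw [le_antisymm hs₀ this.1]
      rw [List.pairwise_append]
      refine ⟨hPadm.2, List.pairwise_cons.2 ⟨hσS, hSadm.2⟩, fun τ hτ τ' hτ' ↦ ?_⟩
      have hlt : τ < τ' := by
        rcases List.mem_cons.1 hτ' with rfl | hτ'
        · exact hPlt τ hτ
        · exact (hPlt τ hτ).trans_le (hSge τ' hτ')
      exact ⟨hlt.le, fun _ ↦ hlt.ne⟩
    · rw [← Module.End.mul_apply, hprod, LinearMap.smul_apply]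

/-- A creation letter `𝔮ₘ(x_c)` maps a sorted admissible monomial with `k` letters into `admSpanGe (k + 1)`. -/
theorem q_letter_apply_mem_admSpanGe (h : IsHeisenbergRepresentation B q vac) (h2 : (2 : K) ≠ 0)
    (hx : ∀ c, x c ∈ LinearMap.range (lof K ℕ A (deg c))) {m : ℕ} (hm : 1 ≤ m) (c : Fin N)
    {L : List (Lex (Fin N × ℕ))} (hL : IsAdmissibleWord deg L) :
    q (m : ℤ) (x c) (monomialOp q (letterWord x L) vac) ∈ admSpanGe q x vac deg (L.length + 1) := by
  rcases q_letter_apply_eq h h2 hx hm c hL with ⟨-, -, h0⟩ | ⟨hadm, heq⟩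
  · rw [h0]; exact Submodule.zero_mem _
  · rw [heq]
    refine Submodule.smul_mem _ _ (monomialOp_vac_mem_admSpanGe hadm (le_of_eq ?_))
    rw [List.length_append, List.length_cons, ← Nat.add_assoc, ← List.length_append, List.takeWhile_append_dropWhile]

/-- **A creation operator raises the letter count**: `𝔮ₘ(v)`, `m > 0`, maps `admSpanGe r` into `admSpanGe (r + 1)` (for a
homogeneous family `x` spanning the coefficient space). -/
theorem q_apply_mem_admSpanGe_succ (h : IsHeisenbergRepresentation B q vac) (h2 : (2 : K) ≠ 0)
    (hx : ∀ c, x c ∈ LinearMap.range (lof K ℕ A (deg c))) (hsp : Submodule.span K (Set.range x) = ⊤)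
    {m : ℤ} (hm : 0 < m) (v : ⨁ i, A i) {r : ℕ} {y : Fock Φ} (hy : y ∈ admSpanGe q x vac deg r) :
    q m v y ∈ admSpanGe q x vac deg (r + 1) := by
  induction hy using Submodule.span_induction with
  | mem w hw =>
    obtain ⟨L, hL, hr, rfl⟩ := hw
    have hv : v ∈ Submodule.span K (Set.range x) := by rw [hsp]; exact Submodule.mem_top
    induction hv using Submodule.span_induction with
    | mem v hv =>
      obtain ⟨c, rfl⟩ := hv
      obtain ⟨m, rfl⟩ := Int.eq_ofNat_of_zero_le hm.le
      exact admSpanGe_anti (by omega) (q_letter_apply_mem_admSpanGe h h2 hx (by exact_mod_cast hm) c hL)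
    | zero => rw [map_zero, LinearMap.zero_apply]; exact Submodule.zero_mem _
    | add a b _ _ ha hb => rw [map_add, LinearMap.add_apply]; exact Submodule.add_mem _ ha hb
    | smul t a _ ha => rw [map_smul, LinearMap.smul_apply]; exact Submodule.smul_mem _ t ha
  | zero => rw [map_zero]; exact Submodule.zero_mem _
  | add a b _ _ ha hb => rw [map_add]; exact Submodule.add_mem _ ha hb
  | smul t a _ ha => rw [map_smul]; exact Submodule.smul_mem _ t ha

/-- A creation word with `ℓ` letters (all modes `≥ 1`, arbitrary coefficients) maps `admSpanGe r` into `admSpanGe (r + ℓ)`. -/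
theorem monomialOp_apply_mem_admSpanGe (h : IsHeisenbergRepresentation B q vac) (h2 : (2 : K) ≠ 0)
    (hx : ∀ c, x c ∈ LinearMap.range (lof K ℕ A (deg c))) (hsp : Submodule.span K (Set.range x) = ⊤)
    (w : List (ℕ × ⨁ i, A i)) (hw : ∀ p ∈ w, 1 ≤ p.1) {r : ℕ} {y : Fock Φ} (hy : y ∈ admSpanGe q x vac deg r) :
    monomialOp q w y ∈ admSpanGe q x vac deg (r + w.length) := by
  induction w with
  | nil => rw [monomialOp_nil, Module.End.one_apply, List.length_nil, Nat.add_zero]; exact hy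
  | cons p w ih =>
    obtain ⟨m, v⟩ := p
    rw [monomialOp_cons, Module.End.mul_apply, List.length_cons, ← Nat.add_assoc]
    have hm : 1 ≤ m := hw (m, v) List.mem_cons_self
    exact q_apply_mem_admSpanGe_succ h h2 hx hsp (by exact_mod_cast hm) v
      (ih fun p hp ↦ hw p (List.mem_cons_of_mem _ hp))

/-- **`ℍₘ ⊆ admSpanGe 1` for `m ≥ 1`**: every vector of positive weight is a combination of admissible monomials with at
least one letter. -/
theorem range_ofSummand_le_admSpanGe_one (h : IsHeisenbergRepresentation B q vac) (h2 : (2 : K) ≠ 0)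
    (hx : ∀ c, x c ∈ LinearMap.range (lof K ℕ A (deg c))) (hsp : Submodule.span K (Set.range x) = ⊤)
    {m : ℕ} (hm : 1 ≤ m) : LinearMap.range (Fock.ofSummand K Φ m) ≤ admSpanGe q x vac deg 1 := by
  refine (h.range_ofSummand_le_span_admissible h2 hx hsp m).trans (Submodule.span_le.2 ?_)
  rintro _ ⟨L, hL, hn, rfl⟩
  refine monomialOp_vac_mem_admSpanGe hL ?_
  rcases L with _ | ⟨τ, L⟩
  · rw [letterWord_nil, wordMode_nil] at hn
    omega
  · exact Nat.succ_le_succ (Nat.zero_le _)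

/-! ### 2. Unit letters commute with everything -/

/-- **A degree-zero letter commutes with every letter of non-complementary mode**: `𝔮ₐ(U) 𝔮_b(v) = 𝔮_b(v) 𝔮ₐ(U)` for
`U` homogeneous of degree `0` (intended `U = 1_S`) and `a + b ≠ 0` (the super-sign is `(−1)^{0·|v|} = 1` and the central
term vanishes). -/
theorem q_unit_mul_q (h : IsHeisenbergRepresentation B q vac) {U : ⨁ i, A i} (hU : U ∈ LinearMap.range (lof K ℕ A 0))
    {a b : ℤ} (hab : a + b ≠ 0) (v : ⨁ i, A i) : q a U * q b v = q b v * q a U := by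
  obtain ⟨u, rfl⟩ := hU
  induction v using DirectSum.induction_on with
  | zero => rw [map_zero, mul_zero, zero_mul]
  | add v v' hv hv' => rw [map_add, mul_add, add_mul, hv, hv']
  | of j b' =>
    rw [← lof_eq_of K]
    have := h.mul_eq_sign_smul_mul hab 0 j u b'
    rwa [zero_mul, pow_zero, one_smul] at this

/-- The unit word `[(a₁, U), …, (a_r, U)]` of a list of parts (all letters carry the same class `U`, intended `1_S`). -/
def unitWord (U : ⨁ i, A i) (l : List ℕ) : List (ℕ × ⨁ i, A i) :=
  l.map fun a ↦ (a, U)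

/-- `unitWord` of the empty list. -/
@[simp]
theorem unitWord_nil (U : ⨁ i, A i) : unitWord U [] = [] := rfl

/-- `unitWord` of a cons. -/
@[simp]
theorem unitWord_cons (U : ⨁ i, A i) (a : ℕ) (l : List ℕ) : unitWord U (a :: l) = (a, U) :: unitWord U l := rfl

/-- `unitWord` of an append. -/
theorem unitWord_append (U : ⨁ i, A i) (l l' : List ℕ) : unitWord U (l ++ l') = unitWord U l ++ unitWord U l' := by
  simp [unitWord]

/-- The length of a unit word. -/
@[simp]
theorem length_unitWord (U : ⨁ i, A i) (l : List ℕ) : (unitWord U l).length = l.length := by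
  simp [unitWord]

/-- The letters of a unit word are `(a, U)`, `a` a part. -/
theorem mem_unitWord_iff (U : ⨁ i, A i) (l : List ℕ) (p : ℕ × ⨁ i, A i) :
    p ∈ unitWord U l ↔ ∃ a ∈ l, p = (a, U) := by
  simp only [unitWord, List.mem_map]
  exact ⟨fun ⟨a, ha, he⟩ ↦ ⟨a, ha, he.symm⟩, fun ⟨a, ha, he⟩ ↦ ⟨a, ha, he.symm⟩⟩

/-- The total mode of a unit word is the sum of its parts. -/
theorem wordMode_unitWord (U : ⨁ i, A i) (l : List ℕ) : wordMode (unitWord U l) = l.sum := by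
  induction l with
  | nil => rfl
  | cons a l ih => rw [unitWord_cons, wordMode_cons, ih, List.sum_cons]

/-- A unit word of weight `m·a` with equal parts is a power of the unit letter: `M_{replicate m a} = 𝔮ₐ(U)^m`. -/
theorem monomialOp_unitWord_replicate (U : ⨁ i, A i) (m a : ℕ) :
    monomialOp q (unitWord U (List.replicate m a)) = q (a : ℤ) U ^ m := by
  induction m with
  | zero => rw [List.replicate_zero, unitWord_nil, monomialOp_nil, pow_zero]
  | succ m ih => rw [List.replicate_succ, unitWord_cons, monomialOp_cons, ih, pow_succ']

/-- **Unit monomials depend only on the multiset of parts**: for `l ~ l'` (all parts `≥ 1`),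
`𝔮_{a₁}(U)⋯𝔮_{a_r}(U) = 𝔮_{a'₁}(U)⋯𝔮_{a'_r}(U)`. -/
theorem monomialOp_unitWord_perm (h : IsHeisenbergRepresentation B q vac) {U : ⨁ i, A i}
    (hU : U ∈ LinearMap.range (lof K ℕ A 0)) {l l' : List ℕ} (hp : l.Perm l') (hl : ∀ a ∈ l, 1 ≤ a) :
    monomialOp q (unitWord U l) = monomialOp q (unitWord U l') := by
  induction hp with
  | nil => rfl
  | cons a _ ih =>
    rw [unitWord_cons, unitWord_cons, monomialOp_cons, monomialOp_cons, ih fun b hb ↦ hl b (List.mem_cons_of_mem a hb)]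
  | swap a b l =>
    rw [unitWord_cons, unitWord_cons, unitWord_cons, unitWord_cons, monomialOp_cons, monomialOp_cons, monomialOp_cons,
      monomialOp_cons, ← mul_assoc, ← mul_assoc, q_unit_mul_q h hU]
    have ha : 1 ≤ a := hl a (List.mem_cons_of_mem b List.mem_cons_self)
    have hb : 1 ≤ b := hl b List.mem_cons_self
    omega
  | trans h₁ _ ih₁ ih₂ =>
    rw [ih₁ hl, ih₂ fun a ha ↦ hl a (h₁.mem_iff.2 ha)]

/-- A unit letter passes through a unit word (all parts `≥ 1`). -/
theorem q_unit_monomialOp_unitWord (h : IsHeisenbergRepresentation B q vac) {U : ⨁ i, A i}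
    (hU : U ∈ LinearMap.range (lof K ℕ A 0)) {a : ℕ} (ha : 1 ≤ a) (l : List ℕ) (hl : ∀ b ∈ l, 1 ≤ b) (y : Fock Φ) :
    q (a : ℤ) U (monomialOp q (unitWord U l) y) = monomialOp q (unitWord U l) (q (a : ℤ) U y) := by
  induction l with
  | nil => rw [unitWord_nil, monomialOp_nil, Module.End.one_apply, Module.End.one_apply]
  | cons b l ih =>
    have hb : 1 ≤ b := hl b List.mem_cons_self
    rw [unitWord_cons, monomialOp_cons, Module.End.mul_apply, Module.End.mul_apply,
      ← ih (fun b' hb' ↦ hl b' (List.mem_cons_of_mem b hb')), ← Module.End.mul_apply, q_unit_mul_q h hU (by omega),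
      Module.End.mul_apply]

end Summit.Ventures.HodgeKum4.L1Hilb.Join

end
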